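import Literature.AlgebraicGeometry.AbelianSchemes.StageDualsOfLetterAmple    -- ★ p848931: FILE 1 (steps 0–5) `exists_stage_rankOne_rigidified_ample`
import Literature.AlgebraicGeometry.AbelianSchemes.StageDualsOfLetterCharts   -- ★ p849003: FILE 2 (steps 6–9) `exists_stage_nonempty_dualPair_of_letter_of_stage`
import HarnessLib

/-!
# «DUALS-AT-STAGE», HEAD: some stage restriction of `𝒜ₜ` carries a DUAL PAIR, given the DUALS letter and a generic polarization
# ([MumfordAV1970] §13 dual abelian variety; [MumfordFogartyKirwan1994] Ch. 6 §1 Cor. 6.8, Ch. 7 §2; [EGAIV3] §8 spreading)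

Layer `Literature/AlgebraicGeometry/AbelianSchemes`, namespace `Literature.AlgebraicGeometry.AbelianSchemes.AbelianSchemeOver`.  THEOREMS ONLY
(no definition, no named fact, no instance, no notation, no `sorry`).  Cell `hodgecm-mathlib` (D-0151), P6 «MOD programme», L4 DUALS road; LA4-plan (g0)
DEAL #9 (LA4-p04 (g0) lead pen) ∕ DEAL #12 (LA4-p05 (g2) FILE 2).  HC_CM is proved only modulo the printed citations (2 remaining named inputs hLiu418
24832, h413 24833) until rung 0 closes; this file is generic and changes no count.

* **`stageDuals_of_letter`** — for `A₁` over the generic base `P ⊗ Spec K` with a dual pair `D₁` and a polarization `pol₁`, and `𝒜ₜ` over the stage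
  `P ⊗ D(t)` of which `A₁` is the base change along the cone leg (`hbc`), GIVEN the DUALS letter `hD` (text of the P-line letter
  `DualPairOfAmpleRigidified`: over a Noetherian affine base a projective abelian scheme with a rigidified rank-one bundle of ample class at every
  geometric point whose `K(L)` is killed by an invertible integer HAS a dual pair), some restriction `𝒜ₜ ×_{P⊗D(t)} (P ⊗ D(s))` carries a dual pair —
  the `hdual` binder of ★ `exists_stage_pelTuple_of_generic_of_stageDuals` VERBATIM (tie `example` below).  Proof = ★ FILE 1
  `exists_stage_rankOne_rigidified_ample` (steps 0–5: Mumford bundle of `pol₁`, spread, rigidified, ample class everywhere on a finer stage, symmetric in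
  characteristic `0`) + ★ FILE 2 `exists_stage_nonempty_dualPair_of_letter_of_stage` (steps 6–9: projective affine charts off finitely many primes,
  one exponent killing `K(L)`, the letter chart by chart, glued by ★ `MumfordDual.nonempty_dualPair_of_charts_of_letter`).

## References
* [MumfordAV1970] D. Mumford, *Abelian Varieties* (1970), §13 (pp. 123–125), §23 (p. 231).
* [MumfordFogartyKirwan1994] D. Mumford, J. Fogarty, F. Kirwan, *Geometric Invariant Theory*, 3rd ed. (1994), Ch. 6 §1 Cor. 6.8 (p. 118), §2 Prop. 6.10 (p. 121), Ch. 7 §2 Def. 7.3 (p. 130).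
* [EGAIV3] A. Grothendieck, J. Dieudonné, *EGA IV₃* (1966), Thm. 8.8.2, Thm. 8.10.5.
-/

set_option autoImplicit false

noncomputable section

set_option backward.isDefEq.respectTransparency false

open CategoryTheory CategoryTheory.Limits AlgebraicGeometry MonoidalCategory CartesianMonoidalCategory
open scoped MonObj
open Literature.AlgebraicGeometry.Limits Literature.AlgebraicGeometry.Limits.LocApprox
open Literature.AlgebraicGeometry.Motives Literature.AlgebraicGeometry.Modules Literature.AlgebraicGeometry.Morphisms

namespace Literature.AlgebraicGeometry.AbelianSchemes

namespace AbelianSchemeOver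

section Head

variable {A : Type} [CommRing A] [IsDedekindDomain A] [CharZero A] [Algebra.IsIntegral ℤ A]
  (K : Type) [Field K] [CharZero K] [Algebra A K] [IsFractionRing A K]
  {P : SchemeOver A} [QuasiCompact P.hom] [QuasiSeparated P.hom] [LocallyOfFinitePresentation P.hom] [Flat P.hom]
  [∀ s : Idx (nonZeroDivisors A), IsLocallyNoetherian (P ⊗ (baseDiagram (nonZeroDivisors A)).obj s).left]

/-- **«DUALS-AT-STAGE»**: given the DUALS letter `hD`, an abelian scheme `A₁` over the generic base `P ⊗ Spec K` with a dual pair and a polarization,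
and `𝒜ₜ` over the stage `P ⊗ D(t)` with `A₁ ≅ 𝒜ₜ ×_{P⊗D(t)} (P ⊗ Spec K)` as group schemes (`hbc`), some stage restriction `𝒜ₜ ×_{P⊗D(t)} (P ⊗ D(s))`
(`σ : s ⟶ t`) carries a dual pair — the `hdual` binder of ★ `exists_stage_pelTuple_of_generic_of_stageDuals`.
[cite: MumfordAV1970, §13 (pp. 123–125)] [cite: MumfordFogartyKirwan1994, Ch. 6 §2 Prop. 6.10 (p. 121) and Ch. 7 §2 Definition 7.3 (p. 130)]
[cite: EGAIV3, Thm. 8.8.2 and Thm. 8.10.5] -/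
theorem stageDuals_of_letter
    (hD : ∀ (R : Type) [CommRing R] [IsNoetherianRing R] (A : AbelianSchemeOver (Spec (.of R)))
      (_hA : IsProjective A.X.hom) (L : A.left.Modules) (hL : HasRank L 1),
      CechPic.pullback A.unitSection (detClass (HasRank.isFiniteLocallyFree' hL)) = 1 →
      (∀ ⦃Ω : Type⦄ [Field Ω] [IsAlgClosed Ω] (s : Spec (.of Ω) ⟶ Spec (.of R)),
        ∃ Θ : CartierDivisor (A.fibre s).toAbelianVariety.X.left, Θ.IsAmple ∧
          CechPic.pullback (X := (A.fibre s).toAbelianVariety.X.left) (pullback.fst A.X.hom s)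
            (detClass (HasRank.isFiniteLocallyFree' hL)) = Θ.cechClass) →
      ∀ (n : ℕ), IsUnit ((n : ℕ) : R) →
        (∀ (T : Over (Spec (.of R))) (u : T ⟶ A.X), A.MemKOfL L u → u ^ n = 1) →
        Nonempty A.DualPair)
    (A₁ : AbelianSchemeOver (P ⊗ specOver A K).left) (D₁ : A₁.DualPair) (pol₁ : A₁.Polarization D₁)
    (t : Idx (nonZeroDivisors A)) (𝒜ₜ : AbelianSchemeOver (P ⊗ (baseDiagram (nonZeroDivisors A)).obj t).left)
    (G : A₁.X.left ⟶ 𝒜ₜ.X.left) (hbc : A₁.IsBaseChangeVia 𝒜ₜ (P ◁ (baseCone (nonZeroDivisors A) K).π.app t).left G) :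
    ∃ (s : Idx (nonZeroDivisors A)) (σ : s ⟶ t), Nonempty (𝒜ₜ.baseChange (stageOver (nonZeroDivisors A) P σ).hom).DualPair := by
  obtain ⟨s₂, ρ, L, hL, hε, hΘ, hwit⟩ := exists_stage_rankOne_rigidified_ample K A₁ D₁ pol₁ t 𝒜ₜ G hbc
  exact exists_stage_nonempty_dualPair_of_letter_of_stage hD 𝒜ₜ ρ L hL hε hΘ hwit

/-- TIE (statement-first): the HEAD discharges the `hdual` binder of ★ p848288 `exists_stage_pelTuple_of_generic_of_stageDuals` on the nose. -/
example [IsSeparated P.hom] [IsLocallyNoetherian (P ⊗ specOver A K).left] [IsReduced (P ⊗ specOver A K).left]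
    (hD : ∀ (R : Type) [CommRing R] [IsNoetherianRing R] (A : AbelianSchemeOver (Spec (.of R)))
      (_hA : IsProjective A.X.hom) (L : A.left.Modules) (hL : HasRank L 1),
      CechPic.pullback A.unitSection (detClass (HasRank.isFiniteLocallyFree' hL)) = 1 →
      (∀ ⦃Ω : Type⦄ [Field Ω] [IsAlgClosed Ω] (s : Spec (.of Ω) ⟶ Spec (.of R)),
        ∃ Θ : CartierDivisor (A.fibre s).toAbelianVariety.X.left, Θ.IsAmple ∧
          CechPic.pullback (X := (A.fibre s).toAbelianVariety.X.left) (pullback.fst A.X.hom s)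
            (detClass (HasRank.isFiniteLocallyFree' hL)) = Θ.cechClass) →
      ∀ (n : ℕ), IsUnit ((n : ℕ) : R) →
        (∀ (T : Over (Spec (.of R))) (u : T ⟶ A.X), A.MemKOfL L u → u ^ n = 1) →
        Nonempty A.DualPair)
    (hP : IsProper (pullback.snd P.hom (specOver A K).hom))
    {O : Type} [CommRing O] {m : ℕ} (bs : Module.Basis (Fin m) ℤ O) {g N : ℕ} [NeZero N] (hN : IsUnit ((N : ℕ) : K))
    (A₁ : AbelianSchemeOver (P ⊗ specOver A K).left) (ρ₁ : RingAction O A₁) (D₁ : A₁.DualPair) (pol₁ : A₁.Polarization D₁)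
    (φ₁ : A₁.LevelStructure g N) (hg : A₁.IsOfRelDim g) : True := by
  have := exists_stage_pelTuple_of_generic_of_stageDuals K hP bs hN A₁ ρ₁ D₁ pol₁ φ₁ hg (stageDuals_of_letter K hD A₁ D₁ pol₁)
  trivial

end Head

end AbelianSchemeOver

end Literature.AlgebraicGeometry.AbelianSchemes

end
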